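import Mathlib
import HarnessLib
import Summits.AtomisticToContinuum.FouriersLaw.Theorems.HiddenChargeMazurDressedChargeStubSeedObstructionAux1
import Summits.AtomisticToContinuum.FouriersLaw.Theorems.HiddenChargeMazurDressedChargeStubSeedObstructionAux2

/-!
# Stub `stub_seedObstruction` of line `birth` (crux `HiddenChargeMazur.DressedCharge`, item
stmt-AtomisticToContinuum-13509; `--supports` helper, closes nothing)

**The seed obstruction.** Let `A(z) = Σ a_m z^m` be a nonzero Laurent polynomial (the
coefficient function of the degree-one seed `u₁ = Σ a_m q_m` of a would-be odd conserved density),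
`ω̃(z) = ω₂ + 2 - z - z⁻¹` (`ω₂ > 0`), `K ≠ 0`, and suppose that for all `z₁, z₂ ≠ 0` and all
`μ₁² = -ω̃ z₁`, `μ₂² = -ω̃ z₂`, `μ₃² = -ω₂`
`((μ₁+μ₂+μ₃)² + ω̃(z₁z₂)) · (c0 + μ₁μ₂ c12 + μ₁μ₃ c13 + μ₂μ₃ c23) = K · (A(z₁z₂) - A z₁ - A z₂
      - A 1)`
with Laurent coefficient functions `c0, c12, c13, c23`. Then `False`.

Proof (pointwise algebra in `…Aux1`, bivariate bookkeeping in `…Aux2`, the two branch factors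
`𝒢` and `Δ` in this file):
1. the trivial resonance `z₁ = z₂ = 1, μ₂ = -μ₃` gives `Σ a_m = 0`; in particular `a` is not
   supported at `0` alone, and by the symmetry `(z, a) ↦ (z⁻¹, a ∘ neg)` we may assume that the
   lowest exponent of `a` is `-D ≤ -1`;
2. multiplying over the sign classes of `(μ₂, μ₃)`: `E₃ · 𝒢 = K⁴ ΔA⁴` on `(ℂˣ)²`, with `E₃` the
   four-phonon resonance quartic and `𝒢` Laurent;
3. along the nontrivial resonance branch `z₁ = s²`, `z₂ = 1 + γ s` every factor becomes, after
   multiplication by a monomial in `s` and `1 + γ s`, a polynomial in `ℂ[γ][s]`; comparing trailing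
   coefficients in `s` (multiplicative over the domain `ℂ[γ]`) gives
   `(γ⁴ + 16 ω₂ γ²) · τ(γ) = K⁴ (D a_{-D})⁴ γ⁴` in `ℂ[γ]`, absurd at `γ₀² = -16 ω₂ ≠ 0`.
-/

noncomputable section

namespace Summit.AtomisticToContinuum.FouriersLaw.Theorems.DressedCharge

open Polynomial
open scoped Polynomial.Bivariate

/-- **`𝒢` is branch-polynomial.** The sign-class product `𝒢` of `seed_signProduct`, evaluated
along `(z₁, z₂) = (s², 1 + γ s)`, becomes a polynomial in `(γ, s)` after multiplication by a
monomial in `s` and `1 + γ s`, provided the four coefficient functions do (structural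
decomposition down to the atoms `c_S`, `s`, `γ`, `s⁻²`, `(1 + γ s)⁻¹` and constants). -/
theorem seed_br_G (ω₂ : ℝ) {c0 c12 c13 c23 : ℂ → ℂ → ℂ}
    (h0 : ∃ (M M' : ℕ) (P : Polynomial (Polynomial ℂ)), ∀ s γ : ℂ, s ≠ 0 → 1 + γ * s ≠ 0 →
        c0 (s ^ 2) (1 + γ * s) * s ^ M * (1 + γ * s) ^ M' = P.evalEval γ s)
    (h12 : ∃ (M M' : ℕ) (P : Polynomial (Polynomial ℂ)), ∀ s γ : ℂ, s ≠ 0 → 1 + γ * s ≠ 0 →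
        c12 (s ^ 2) (1 + γ * s) * s ^ M * (1 + γ * s) ^ M' = P.evalEval γ s)
    (h13 : ∃ (M M' : ℕ) (P : Polynomial (Polynomial ℂ)), ∀ s γ : ℂ, s ≠ 0 → 1 + γ * s ≠ 0 →
        c13 (s ^ 2) (1 + γ * s) * s ^ M * (1 + γ * s) ^ M' = P.evalEval γ s)
    (h23 : ∃ (M M' : ℕ) (P : Polynomial (Polynomial ℂ)), ∀ s γ : ℂ, s ≠ 0 → 1 + γ * s ≠ 0 →
        c23 (s ^ 2) (1 + γ * s) * s ^ M * (1 + γ * s) ^ M' = P.evalEval γ s) :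
    ∃ (M M' : ℕ) (P : Polynomial (Polynomial ℂ)), ∀ s γ : ℂ, s ≠ 0 → 1 + γ * s ≠ 0 →
        (c0 (s ^ 2) (1 + γ * s) ^ 4 + (((ω₂ : ℂ) + 2 - (s ^ 2) - (s ^ 2)⁻¹) * ((ω₂ : ℂ) + 2 - (1 + γ
              * s) - (1 + γ * s)⁻¹) * c12 (s ^ 2) (1 + γ * s) ^ 2) ^ 2 + (((ω₂ : ℂ) + 2 - (s ^ 2)
              - (s ^ 2)⁻¹) * (ω₂ : ℂ) * c13 (s ^ 2) (1 + γ * s) ^ 2) ^ 2 + (((ω₂ : ℂ) + 2 - (1 + γ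
              * s) - (1 + γ * s)⁻¹) * (ω₂ : ℂ) * c23 (s ^ 2) (1 + γ * s) ^ 2) ^ 2 - 2
              * (c0 (s ^ 2) (1 + γ * s) ^ 2 * (((ω₂ : ℂ) + 2 - (s ^ 2) - (s ^ 2)⁻¹) * ((ω₂ : ℂ) + 2
              - (1 + γ * s) - (1 + γ * s)⁻¹) * c12 (s ^ 2) (1 + γ * s) ^ 2) + c0 (s ^ 2) (1 + γ
              * s) ^ 2 * (((ω₂ : ℂ) + 2 - (s ^ 2) - (s ^ 2)⁻¹) * (ω₂ : ℂ) * c13 (s ^ 2) (1 + γ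
              * s) ^ 2) + c0 (s ^ 2) (1 + γ * s) ^ 2 * (((ω₂ : ℂ) + 2 - (1 + γ * s) - (1 + γ * s)⁻¹)
              * (ω₂ : ℂ) * c23 (s ^ 2) (1 + γ * s) ^ 2) + (((ω₂ : ℂ) + 2 - (s ^ 2) - (s ^ 2)⁻¹)
              * ((ω₂ : ℂ) + 2 - (1 + γ * s) - (1 + γ * s)⁻¹) * c12 (s ^ 2) (1 + γ * s) ^ 2)
              * (((ω₂ : ℂ) + 2 - (s ^ 2) - (s ^ 2)⁻¹) * (ω₂ : ℂ) * c13 (s ^ 2) (1 + γ * s) ^ 2)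
              + (((ω₂ : ℂ) + 2 - (s ^ 2) - (s ^ 2)⁻¹) * ((ω₂ : ℂ) + 2 - (1 + γ * s) - (1 + γ * s)⁻¹)
              * c12 (s ^ 2) (1 + γ * s) ^ 2) * (((ω₂ : ℂ) + 2 - (1 + γ * s) - (1 + γ * s)⁻¹)
              * (ω₂ : ℂ) * c23 (s ^ 2) (1 + γ * s) ^ 2) + (((ω₂ : ℂ) + 2 - (s ^ 2) - (s ^ 2)⁻¹)
              * (ω₂ : ℂ) * c13 (s ^ 2) (1 + γ * s) ^ 2) * (((ω₂ : ℂ) + 2 - (1 + γ * s) - (1 + γ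
              * s)⁻¹) * (ω₂ : ℂ) * c23 (s ^ 2) (1 + γ * s) ^ 2)) - 8 * c0 (s ^ 2) (1 + γ * s)
              * (((ω₂ : ℂ) + 2 - (s ^ 2) - (s ^ 2)⁻¹) * ((ω₂ : ℂ) + 2 - (1 + γ * s) - (1 + γ * s)⁻¹)
              * (ω₂ : ℂ) * (c12 (s ^ 2) (1 + γ * s) * c13 (s ^ 2) (1 + γ * s) * c23 (s ^ 2) (1 + γ
              * s)))) * s ^ M * (1 + γ * s) ^ M' = P.evalEval γ s := by
  repeat' first
    | with_reducible apply seed_br_pow | with_reducible apply seed_br_mul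
    | with_reducible apply seed_br_add | with_reducible apply seed_br_sub
    | with_reducible exact h0 | with_reducible exact h12 | with_reducible exact h13
    | with_reducible exact h23 | with_reducible exact seed_br_s | with_reducible exact seed_br_γ
    | with_reducible exact seed_br_inv_sq | with_reducible exact seed_br_inv_lin
    | exact seed_br_const _

/-- One term of `Δ`: `s`-derivative at `s = 0` of `c (s^{2k} - s^{2D})((1+γs)^k - (1+γs)^D)` is
`-c D γ` for `k = 0` and `0` for `k ≥ 1` (`D ≥ 1`). -/
theorem seed_delta_term (c : ℂ) (k D : ℕ) (hD : 1 ≤ D) :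
    eval 0 (derivative (C (C c) * (((Y : ℂ[X][Y]) ^ (2 * k) - Y ^ (2 * D)) *
      ((1 + C X * Y) ^ k - (1 + C X * Y) ^ D)))) = if k = 0 then C (-(c * D)) * X else 0 := by
  have hD0 : 2 * D ≠ 0 := by omega
  have hD1 : 2 * D - 1 ≠ 0 := by omega
  rcases Nat.eq_zero_or_pos k with rfl | hk
  · simp [hD0, derivative_mul, derivative_pow]
    ring
  · have hk0 : 2 * k ≠ 0 := by omega
    have hk1 : 2 * k - 1 ≠ 0 := by omega
    simp [hD0, hD1, hk0, hk1, hk.ne', derivative_mul, derivative_pow]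

/-- **The seed difference along the branch.** See the module docstring. -/
theorem seed_exists_branchDelta (a : ℤ →₀ ℂ) {D : ℕ} (hD : 1 ≤ D) (haD : a (-(D : ℤ)) ≠ 0)
    (hsupp : ∀ m : ℤ, a m ≠ 0 → -(D : ℤ) ≤ m) (hsum : a.sum (fun _ c => c) = 0) :
    ∃ Δ : ℂ[X][Y], Δ.trailingCoeff = C (-(a (-(D : ℤ)) * D)) * X ∧
      ∀ s γ : ℂ, s ≠ 0 → 1 + γ * s ≠ 0 →
        Δ.evalEval γ s = (a.sum (fun m c => c * ((s ^ 2) * (1 + γ * s)) ^ m) - a.sum (fun m c => c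
              * (s ^ 2) ^ m) - a.sum (fun m c => c * (1 + γ * s) ^ m) - a.sum (fun m c => c
              * ((1 : ℂ)) ^ m)) * s ^ (2 * D) * (1 + γ * s) ^ D := by
  refine ⟨∑ m ∈ a.support, C (C (a m)) * (((Y : ℂ[X][Y]) ^ (2 * (m + D).toNat) - Y ^ (2 * D)) *
      ((1 + C X * Y) ^ (m + D).toNat - (1 + C X * Y) ^ D)), ?_, fun s γ hs h1 => ?_⟩
  · -- trailing coefficient
    have hc0 : (∑ m ∈ a.support, C (C (a m)) * (((Y : ℂ[X][Y]) ^ (2 * (m + D).toNat) - Y ^ (2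
          * D)) *
        ((1 + C X * Y) ^ (m + D).toNat - (1 + C X * Y) ^ D))).coeff 0 = 0 := by
      rw [coeff_zero_eq_eval_zero, eval_finsetSum]
      exact Finset.sum_eq_zero fun m _ => by simp
    have hc1 : (∑ m ∈ a.support, C (C (a m)) * (((Y : ℂ[X][Y]) ^ (2 * (m + D).toNat) - Y ^ (2
          * D)) *
        ((1 + C X * Y) ^ (m + D).toNat - (1 + C X * Y) ^ D))).coeff 1 = C (-(a (-(D : ℤ)) * D))
              * X := by
      have hd : ∀ P : ℂ[X][Y], P.coeff 1 = eval 0 (derivative P) := fun P => by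
        rw [← coeff_zero_eq_eval_zero, coeff_derivative]; simp
      rw [hd, derivative_sum, eval_finsetSum]
      simp only [seed_delta_term _ _ _ hD]
      rw [Finset.sum_eq_single (-(D : ℤ))]
      · simp
      · intro m hm hne
        have h1 : (m + D).toNat ≠ 0 := by
          have := hsupp m (Finsupp.mem_support_iff.mp hm)
          rw [Ne, Int.toNat_eq_zero]; omega
        simp [h1]
      · intro h
        exact absurd (Finsupp.mem_support_iff.mpr haD) h
    have hne : C (-(a (-(D : ℤ)) * D)) * (X : ℂ[X]) ≠ 0 :=
      mul_ne_zero (C_ne_zero.mpr (neg_ne_zero.mpr (mul_ne_zero haD (by exact_mod_cast (show D ≠ 0 by omega)))))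
        X_ne_zero
    rw [← hc1]
    exact seed_trailingCoeff_of_coeff (n := 1) (fun m hm => by interval_cases m; exact hc0) (by rwa [hc1])
  · -- evaluation
    rw [evalEval_finsetSum]
    simp only [evalEval_mul, evalEval_C, eval_C, evalEval_sub, evalEval_pow, evalEval_X, evalEval_add,
      evalEval_one, eval_X]
    have key : ∀ m ∈ a.support, a m * ((s ^ (2 * (m + D).toNat) - s ^ (2 * D)) *
        ((1 + γ * s) ^ (m + D).toNat - (1 + γ * s) ^ D)) =
        (a m * ((s ^ 2) * (1 + γ * s)) ^ m - a m * (s ^ 2) ^ m - a m * (1 + γ * s) ^ m - a m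
              * ((1 : ℂ)) ^ m)
          * s ^ (2 * D) * (1 + γ * s) ^ D + a m * (2 * (s ^ (2 * D) * (1 + γ * s) ^ D)) := by
      intro m hm
      have hm' : -(D : ℤ) ≤ m := hsupp m (Finsupp.mem_support_iff.mp hm)
      have hk : (((m + D).toNat : ℕ) : ℤ) = m + D := Int.toNat_of_nonneg (by omega)
      have e1 : s ^ (2 * (m + D).toNat) = (s ^ 2) ^ m * s ^ (2 * D) := by
        rw [pow_mul, ← zpow_natCast (s ^ 2) ((m + D).toNat), hk, zpow_add₀ (pow_ne_zero 2 hs),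
          zpow_natCast, ← pow_mul]
      have e2 : (1 + γ * s) ^ (m + D).toNat = (1 + γ * s) ^ m * (1 + γ * s) ^ D := by
        rw [← zpow_natCast (1 + γ * s) ((m + D).toNat), hk, zpow_add₀ h1, zpow_natCast]
      rw [e1, e2, mul_zpow, one_zpow]
      ring
    rw [Finset.sum_congr rfl key, Finset.sum_add_distrib, ← Finset.sum_mul, ← Finset.sum_mul,
      ← Finset.sum_mul]
    have h0 : ∑ m ∈ a.support, a m = 0 := hsum
    rw [h0, zero_mul, add_zero]
    simp only [Finset.sum_sub_distrib]
    rfl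

/-- **Core case** of the seed obstruction: `a` has a negative exponent. -/
theorem seed_core {ω₂ : ℝ} (hω : 0 < ω₂) {K : ℂ} (hK : K ≠ 0) {a : ℤ →₀ ℂ}
    {c0 c12 c13 c23 : ℂ → ℂ → ℂ}
    (hL : ∀ f ∈ [c0, c12, c13, c23], ∃ (N : ℕ) (p : MvPolynomial (Fin 2) ℂ), ∀ z₁ z₂ : ℂ, z₁ ≠ 0
          → z₂ ≠ 0 →
        f z₁ z₂ * (z₁ * z₂) ^ N = MvPolynomial.eval ![z₁, z₂] p)
    (hid : ∀ z₁ z₂ μ₁ μ₂ μ₃ : ℂ, z₁ ≠ 0 → z₂ ≠ 0 →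
        μ₁ ^ 2 = -((ω₂ : ℂ) + 2 - (z₁) - (z₁)⁻¹) → μ₂ ^ 2 = -((ω₂ : ℂ) + 2 - (z₂) - (z₂)⁻¹) →
        μ₃ ^ 2 = -(ω₂ : ℂ) →
        ((μ₁ + μ₂ + μ₃) ^ 2 + ((ω₂ : ℂ) + 2 - (z₁ * z₂) - (z₁ * z₂)⁻¹)) *
            (c0 z₁ z₂ + μ₁ * μ₂ * c12 z₁ z₂ + μ₁ * μ₃ * c13 z₁ z₂ + μ₂ * μ₃ * c23 z₁ z₂) =
          K * (a.sum (fun m c => c * ((z₁) * (z₂)) ^ m) - a.sum (fun m c => c * (z₁) ^ m)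
                - a.sum (fun m c => c * (z₂) ^ m) - a.sum (fun m c => c * ((1 : ℂ)) ^ m)))
    (hneg : ∃ m : ℤ, m < 0 ∧ a m ≠ 0) : False := by
  classical
  have hsum := seed_sum_eq_zero hK hid
  -- the lowest exponent `-D`
  obtain ⟨m₀, hm₀neg, hm₀⟩ := hneg
  have hne : a.support.Nonempty := ⟨m₀, Finsupp.mem_support_iff.mpr hm₀⟩
  have hμle : ∀ m, a m ≠ 0 → a.support.min' hne ≤ m := fun m hm =>
    Finset.min'_le _ _ (Finsupp.mem_support_iff.mpr hm)
  have hμneg : a.support.min' hne < 0 := lt_of_le_of_lt (hμle m₀ hm₀) hm₀neg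
  obtain ⟨D, hD⟩ : ∃ D : ℕ, (D : ℤ) = -a.support.min' hne :=
    ⟨(-a.support.min' hne).toNat, Int.toNat_of_nonneg (by omega)⟩
  have hD1 : 1 ≤ D := by omega
  have haD : a (-(D : ℤ)) ≠ 0 := by
    rw [hD, neg_neg]; exact Finsupp.mem_support_iff.mp (Finset.min'_mem _ _)
  have hsupp : ∀ m : ℤ, a m ≠ 0 → -(D : ℤ) ≤ m := fun m hm => by
    rw [hD, neg_neg]; exact hμle m hm
  -- the three factors along the branch
  obtain ⟨Δ, hΔtc, hΔev⟩ := seed_exists_branchDelta a hD1 haD hsupp hsum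
  obtain ⟨E₁, hE₁c, hE₁ev⟩ := seed_exists_branchE ω₂
  obtain ⟨M, M', P, hP⟩ := seed_br_G ω₂ (seed_br_of_laurent (hL c0 (by simp)))
    (seed_br_of_laurent (hL c12 (by simp))) (seed_br_of_laurent (hL c13 (by simp)))
    (seed_br_of_laurent (hL c23 (by simp)))
  -- the polynomial identity in `ℂ[γ][s]`
  have hPI : E₁ * P * (Y ^ (8 * D) * (1 + C X * Y) ^ (4 * D)) * (Y ^ 1 * (1 + C X * Y) ^ 1) =
      C (C (K ^ 4)) * Δ ^ 4 * (Y ^ (4 + M) * (1 + C X * Y) ^ (4 + M')) *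
        (Y ^ 1 * (1 + C X * Y) ^ 1) := by
    refine seed_branch_ext fun s γ hs h1 => ?_
    have h3 := seed_signProduct hid (pow_ne_zero 2 hs) h1 rfl rfl rfl
    have h4 := hP s γ hs h1
    have h5 := hΔev s γ hs h1
    have h6 := hE₁ev s γ hs h1 _ _ _ rfl rfl rfl
    generalize hE : ((((ω₂ : ℂ) + 2 - (s ^ 2) * (1 + γ * s) - ((s ^ 2) * (1 + γ * s))⁻¹) ^ 2
          + ((ω₂ : ℂ) + 2 - (s ^ 2) - (s ^ 2)⁻¹) ^ 2 + ((ω₂ : ℂ) + 2 - (1 + γ * s) - (1 + γ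
          * s)⁻¹) ^ 2 + (ω₂ : ℂ) ^ 2 - 2 * (((ω₂ : ℂ) + 2 - (s ^ 2) * (1 + γ * s) - ((s ^ 2) * (1
          + γ * s))⁻¹) * ((ω₂ : ℂ) + 2 - (s ^ 2) - (s ^ 2)⁻¹) + ((ω₂ : ℂ) + 2 - (s ^ 2) * (1 + γ
          * s) - ((s ^ 2) * (1 + γ * s))⁻¹) * ((ω₂ : ℂ) + 2 - (1 + γ * s) - (1 + γ * s)⁻¹)
          + ((ω₂ : ℂ) + 2 - (s ^ 2) * (1 + γ * s) - ((s ^ 2) * (1 + γ * s))⁻¹) * (ω₂ : ℂ)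
          + ((ω₂ : ℂ) + 2 - (s ^ 2) - (s ^ 2)⁻¹) * ((ω₂ : ℂ) + 2 - (1 + γ * s) - (1 + γ * s)⁻¹)
          + ((ω₂ : ℂ) + 2 - (s ^ 2) - (s ^ 2)⁻¹) * (ω₂ : ℂ) + ((ω₂ : ℂ) + 2 - (1 + γ * s) - (1 + γ
          * s)⁻¹) * (ω₂ : ℂ))) ^ 2 - 64 * ((ω₂ : ℂ) + 2 - (s ^ 2) * (1 + γ * s) - ((s ^ 2) * (1 + γ
          * s))⁻¹) * ((ω₂ : ℂ) + 2 - (s ^ 2) - (s ^ 2)⁻¹) * ((ω₂ : ℂ) + 2 - (1 + γ * s) - (1 + γ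
          * s)⁻¹) * (ω₂ : ℂ)) = Ev at h3 h6
    generalize hG : (c0 (s ^ 2) (1 + γ * s) ^ 4 + (((ω₂ : ℂ) + 2 - (s ^ 2) - (s ^ 2)⁻¹) * ((ω₂ : ℂ)
          + 2 - (1 + γ * s) - (1 + γ * s)⁻¹) * c12 (s ^ 2) (1 + γ * s) ^ 2) ^ 2 + (((ω₂ : ℂ) + 2
          - (s ^ 2) - (s ^ 2)⁻¹) * (ω₂ : ℂ) * c13 (s ^ 2) (1 + γ * s) ^ 2) ^ 2 + (((ω₂ : ℂ) + 2 - (1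
          + γ * s) - (1 + γ * s)⁻¹) * (ω₂ : ℂ) * c23 (s ^ 2) (1 + γ * s) ^ 2) ^ 2 - 2
          * (c0 (s ^ 2) (1 + γ * s) ^ 2 * (((ω₂ : ℂ) + 2 - (s ^ 2) - (s ^ 2)⁻¹) * ((ω₂ : ℂ) + 2 - (1
          + γ * s) - (1 + γ * s)⁻¹) * c12 (s ^ 2) (1 + γ * s) ^ 2) + c0 (s ^ 2) (1 + γ * s) ^ 2
          * (((ω₂ : ℂ) + 2 - (s ^ 2) - (s ^ 2)⁻¹) * (ω₂ : ℂ) * c13 (s ^ 2) (1 + γ * s) ^ 2)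
          + c0 (s ^ 2) (1 + γ * s) ^ 2 * (((ω₂ : ℂ) + 2 - (1 + γ * s) - (1 + γ * s)⁻¹) * (ω₂ : ℂ)
          * c23 (s ^ 2) (1 + γ * s) ^ 2) + (((ω₂ : ℂ) + 2 - (s ^ 2) - (s ^ 2)⁻¹) * ((ω₂ : ℂ) + 2
          - (1 + γ * s) - (1 + γ * s)⁻¹) * c12 (s ^ 2) (1 + γ * s) ^ 2) * (((ω₂ : ℂ) + 2 - (s ^ 2)
          - (s ^ 2)⁻¹) * (ω₂ : ℂ) * c13 (s ^ 2) (1 + γ * s) ^ 2) + (((ω₂ : ℂ) + 2 - (s ^ 2)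
          - (s ^ 2)⁻¹) * ((ω₂ : ℂ) + 2 - (1 + γ * s) - (1 + γ * s)⁻¹) * c12 (s ^ 2) (1 + γ * s) ^ 2)
          * (((ω₂ : ℂ) + 2 - (1 + γ * s) - (1 + γ * s)⁻¹) * (ω₂ : ℂ) * c23 (s ^ 2) (1 + γ * s) ^ 2)
          + (((ω₂ : ℂ) + 2 - (s ^ 2) - (s ^ 2)⁻¹) * (ω₂ : ℂ) * c13 (s ^ 2) (1 + γ * s) ^ 2)
          * (((ω₂ : ℂ) + 2 - (1 + γ * s) - (1 + γ * s)⁻¹) * (ω₂ : ℂ) * c23 (s ^ 2) (1 + γ * s) ^ 2))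
          - 8 * c0 (s ^ 2) (1 + γ * s) * (((ω₂ : ℂ) + 2 - (s ^ 2) - (s ^ 2)⁻¹) * ((ω₂ : ℂ) + 2 - (1
          + γ * s) - (1 + γ * s)⁻¹) * (ω₂ : ℂ) * (c12 (s ^ 2) (1 + γ * s) * c13 (s ^ 2) (1 + γ * s)
          * c23 (s ^ 2) (1 + γ * s)))) = Gv at h3 h4
    generalize hR : (a.sum (fun m c => c * ((s ^ 2) * (1 + γ * s)) ^ m) - a.sum (fun m c => c
          * (s ^ 2) ^ m) - a.sum (fun m c => c * (1 + γ * s) ^ m) - a.sum (fun m c => c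
          * ((1 : ℂ)) ^ m)) = Rv at h3 h5
    simp only [evalEval_mul, evalEval_pow, evalEval_X, evalEval_C, eval_C, evalEval_add, evalEval_one,
      eval_X, h5, h6, ← h4]
    generalize 1 + γ * s = L at h3 h4 h5 h6 ⊢
    linear_combination (s ^ (4 + M + 8 * D) * L ^ (4 + M' + 4 * D)) * h3
  -- trailing coefficients
  have hX : (X ^ 4 + C (16 * (ω₂ : ℂ)) * X ^ 2 : ℂ[X]) ≠ 0 := by
    intro h
    have h' := congrArg (Polynomial.eval 1) h
    simp only [eval_add, eval_pow, eval_X, eval_mul, eval_C, one_pow, mul_one, eval_zero] at h'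
    have h'' : (1 + 16 * ω₂ : ℝ) = 0 := by exact_mod_cast h'
    linarith
  have hE₁tc : E₁.trailingCoeff = X ^ 4 + C (16 * (ω₂ : ℂ)) * X ^ 2 := by
    rw [trailingCoeff_eq_coeff_zero (by rw [hE₁c]; exact hX), hE₁c]
  have htc := congrArg Polynomial.trailingCoeff hPI
  simp only [trailingCoeff_mul, seed_trailingCoeff_pow, seed_trailingCoeff_Y, seed_trailingCoeff_L,
    seed_trailingCoeff_C, hΔtc, hE₁tc, one_pow, mul_one] at htc
  -- evaluate at `γ₀`, `γ₀² = -16 ω₂`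
  obtain ⟨γ₀, hγ₀⟩ := IsAlgClosed.exists_pow_nat_eq (-(16 * (ω₂ : ℂ))) two_pos
  have hγ₀ne : γ₀ ≠ 0 := by
    rintro rfl
    have h' : (16 * ω₂ : ℝ) = 0 := by exact_mod_cast (neg_eq_zero.mp (by simpa using hγ₀.symm))
    linarith
  have hev := congrArg (Polynomial.eval γ₀) htc
  simp only [eval_mul, eval_pow, eval_add, eval_C, eval_X] at hev
  have hz : γ₀ ^ 4 + 16 * (ω₂ : ℂ) * γ₀ ^ 2 = 0 := by linear_combination γ₀ ^ 2 * hγ₀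
  have hD0 : (D : ℂ) ≠ 0 := by exact_mod_cast (show D ≠ 0 by omega)
  have hne : K ^ 4 * (-(a (-(D : ℤ)) * D) * γ₀) ^ 4 ≠ 0 :=
    mul_ne_zero (pow_ne_zero 4 hK)
      (pow_ne_zero 4 (mul_ne_zero (neg_ne_zero.mpr (mul_ne_zero haD hD0)) hγ₀ne))
  exact hne (by linear_combination -hev + eval γ₀ P.trailingCoeff * hz)

/-- **Registered stub `stub_seedObstruction` (F) of line `birth`.** See the module docstring. -/
theorem stub_seedObstruction :
    ∀ (ω₂ : ℝ), 0 < ω₂ → ∀ (K : ℂ), K ≠ 0 → ∀ (a : ℤ →₀ ℂ), a ≠ 0 →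
    ∀ c0 c12 c13 c23 : ℂ → ℂ → ℂ,
      (∀ f ∈ [c0, c12, c13, c23], ∃ (N : ℕ) (p : MvPolynomial (Fin 2) ℂ), ∀ z₁ z₂ : ℂ, z₁ ≠ 0 → z₂ ≠ 0 →
          f z₁ z₂ * (z₁ * z₂) ^ N = MvPolynomial.eval ![z₁, z₂] p) →
      (∀ z₁ z₂ μ₁ μ₂ μ₃ : ℂ, z₁ ≠ 0 → z₂ ≠ 0 →
          μ₁ ^ 2 = -((ω₂ : ℂ) + 2 - (z₁) - (z₁)⁻¹) → μ₂ ^ 2 = -((ω₂ : ℂ) + 2 - (z₂) - (z₂)⁻¹) → μ₃ ^ 2 = -(ω₂ : ℂ) →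
          ((μ₁ + μ₂ + μ₃) ^ 2 + ((ω₂ : ℂ) + 2 - (z₁ * z₂) - (z₁ * z₂)⁻¹)) *
              (c0 z₁ z₂ + μ₁ * μ₂ * c12 z₁ z₂ + μ₁ * μ₃ * c13 z₁ z₂ + μ₂ * μ₃ * c23 z₁ z₂) =
            K * (a.sum (fun m c => c * (z₁ * z₂) ^ m) - a.sum (fun m c => c * (z₁) ^ m) - a.sum (fun m c => c * (z₂) ^ m) - a.sum (fun m c => c * ((1 : ℂ)) ^ m))) →
      False := by
  intro ω₂ hω K hK a ha c0 c12 c13 c23 hL hid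
  by_cases hneg : ∃ m : ℤ, m < 0 ∧ a m ≠ 0
  · exact seed_core hω hK hL hid hneg
  by_cases hpos : ∃ m : ℤ, 0 < m ∧ a m ≠ 0
  · obtain ⟨m, hm, ham⟩ := hpos
    have hL' : ∀ f ∈ [(fun z₁ z₂ => c0 z₁⁻¹ z₂⁻¹), (fun z₁ z₂ => c12 z₁⁻¹ z₂⁻¹), (fun z₁ z₂ => c13 z₁⁻¹ z₂⁻¹),
        (fun z₁ z₂ => c23 z₁⁻¹ z₂⁻¹)], ∃ (N : ℕ) (p : MvPolynomial (Fin 2) ℂ), ∀ z₁ z₂ : ℂ, z₁ ≠ 0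
              → z₂ ≠ 0 →
        f z₁ z₂ * (z₁ * z₂) ^ N = MvPolynomial.eval ![z₁, z₂] p := by
      intro f hf
      simp only [List.mem_cons, List.not_mem_nil, or_false] at hf
      rcases hf with rfl | rfl | rfl | rfl
      · exact seed_reflect_laurent (hL c0 (by simp))
      · exact seed_reflect_laurent (hL c12 (by simp))
      · exact seed_reflect_laurent (hL c13 (by simp))
      · exact seed_reflect_laurent (hL c23 (by simp))
    refine seed_core (a := Finsupp.equivMapDomain (Equiv.neg ℤ) a) hω hK hL' (seed_reflect_id hid)
      ⟨-m, by omega, ?_⟩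
    rwa [Finsupp.equivMapDomain_apply, Equiv.neg_symm, Equiv.neg_apply, neg_neg]
  · simp only [not_exists, not_and, not_not] at hneg hpos
    apply ha
    have hsum := seed_sum_eq_zero hK hid
    have h0 : ∀ m : ℤ, m ≠ 0 → a m = 0 := fun m hm0 => by
      rcases lt_or_gt_of_ne hm0 with h | h
      · exact hneg m h
      · exact hpos m h
    rw [Finsupp.sum_eq_single 0 (fun b _ hb0 => h0 b hb0) (fun _ => rfl)] at hsum
    ext m
    by_cases hm : m = 0
    · rw [hm, hsum]; rfl
    · exact h0 m hm

end Summit.AtomisticToContinuum.FouriersLaw.Theorems.DressedCharge
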